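import Literature.MathematicalPhysics.QuantumFieldTheory.Balaban1983to89.B1Eq324BenfattoClassSectEMemberPrecisionDoorAtOneStar
import Literature.MathematicalPhysics.QuantumFieldTheory.Balaban1983to89.B1Eq324BenfattoClassSectEMemberERowsAtNode00Star

/-!
# `Balaban1983to89.B1Eq324BenfattoClassSectEMemberPrecisionDoorOnLambdaStar` — THE (3.24) PRECISION DOOR FOR `dμ_{C̃^{(k)}(Λ; U)}` AT NODE 00's STAR
# SECT. E LETTERS: p676397 `…PrecisionDoorOnLambda` §1–§3 with the STAR sector `P_Λ^st` (bonds with at least one end block in `Λ′`, [4] (2.3) ∕ Lemma 2.4)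
# for def-Y's source sector `P_Λ`, the star letter record `SectELettersStY` and the star dressed letters `C_st ∕ C_st* ∕ C_st*Δ_kC_st`
# (def-Y STAR EDITION parts 1–3; seat dag-n08-b g37, INTENT-22; node N08 [Balaban1985UV3], row `h324c`)

statement-level companion of published sources with citation tags; every declaration here is a theorem; nothing here is a claim about the
Yang–Mills mass gap

THE PRINTED LOCUS.  [Balaban1985BackgroundPropagators] (= [B9]) Sect. E p. 428: *"This form is considered on the subspace {B : B = 0 on Λᶜ, …} … B = CB̃ …
(C\*Δ_kC)⁻¹ = C̃^{(k)}(Λ)"* with [4] (2.3) p. 224 ∕ Lemma 2.4 p. 245: «Λ also a set of bonds b such that at least one of the end-points b₋, b₊ belongs to Λ» (STAR);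
[Balaban1985UV3] (= [B10]) (24) p. 262: the cumulant bound for `dμ_{C^{(k)}}`, via [Balaban1982Higgs1] (3.24) ∕ [BenfattoEtAl1978] Lemma (4.5)–(4.7) p. 152.

WHY THIS FILE.  The generic precision door p669260 `…CoReadProduct.eq324_CsDeltaCY_precision_node00_on_unit` and its Λ-truncated edition p676397 are typed over
def-Y's SOURCE-convention record `SectELettersY` ∕ sector `secΛY` (variables with base block in `Λ`), where at `U = 1` the `γ₀` row is unsatisfiable at
slab members (CHECK-L).  Print's variables and constraints are the STAR sets; the star letters are def-Y's STAR EDITION (`OpsYSectEStarGeometry`,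
`OpsYSectEStar`, `OpsYSectEElimStar`), whose `γ₀` row at `U = 1` is a THEOREM for every member (p-INTENT-20 `…PrecisionDoorAtOneStar` §3).  THIS FILE re-types
p676397 §1–§3 at the star letters, VERBATIM in structure (the generic matrix door `…AtNode00.eq324_sectEPrecision_node00_on_unit` and the `…CoRead ∕
…CoReadProduct` frame algebra are used BY NAME; only the sector and the letter record change):
* §1 the STAR-truncated letters `P′ := P_Λ^st (QG₁Q*)⁻¹ P_Λ^st`, `J′ := P_Λ^st (a + ⟨D̃⁽²⁾·,J⟩) P_Λ^st`: ★ `CsDeltaCstY_eq_secΛstY` (`C_st*Δ_kC_st = C_st*·(P′ − J′)·C_st`: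
  `C_st*` reads and `C_st` writes STAR bonds only), `restrictScalars_…`, `smul_CsDeltaCstY_eq_secΛstY` (print-unit scale `λ`), ★★
  `coordMatrix_(smul_)CsDeltaCstY_eq_sandwich_secΛstY` (`𝕄_ι(λ·C_st*Δ_kC_st) = Eᵀ(𝕄(P′) − 0·1 − 𝕄(J′))E`), the `E`-rows from operator currency
  `locality_coord_of_elimCΛstY ∕ colMass_coord_of_elimCΛstY`.
* §2 ★★★ `eq324_CsDeltaCstY_precision_node00_onΛst_on_unit` — THE GENERIC (3.24) PRECISION DOOR AT THE STAR LETTERS: p676397 §2 with `𝔢 : SectELettersStY`, the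
  two kernel readings (R2′a) of `λ(QG₁Q*)⁻¹(U)` and (R2′b) of `λ(a + ⟨D̃⁽²⁾·,J⟩(U))` asked between STAR bonds `u, v` (`inΛstY` — still top level, where (3.132)'s
  level prefactors are constants), (R3′) `C_st ∕ C_st*` β-adjoint, (R4′) locality + column mass of `C_st`, (R5′) `γ₀` for `λ·C_st*Δ_kC_st` on `ι`-supported `Φ`;
  conclusion (3.24) for `𝒩(0, 𝕄_ι(λ·C_st*Δ_kC_st)⁻¹)`.
* §3 ★★★ `eq324_CsDeltaCstY_precision_ofRecordTC_trBasis_onΛst_on_unit` — the record-fibre edition (`M_N(ℂ)`, real trace frame `trBasis`, pairing `trReForm`) at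
  the seven-letter STAR record `sectELettersStYOfRecordTC x 𝔳 𝔢₀`: (R1′) in `IsSymmTr 1` currency, (R3′) DISCHARGED by `…PrecisionDoorAtOneStar.sum_trReForm_elimCΛstY_ofRecordTC`
  (unitary `V` + star pivot units), frame constants `1`, (R5′) in `trIP 1`.
* §4 ★★★ `eq324_CsDeltaCPstY_sectEStYOfRecordV7_trBasis_of_units_onΛst_on_unit` — THE DOOR OF RECORD AT THE STAR LETTERS, GENERAL BACKGROUND `U`: at the v4 letters
  of record `lettersYOfRecordV4 N θ M⋆ 𝔯 x` and the v7 STAR record `sectEStYOfRecordV7 N θ M⋆ 𝔢₀ x`, print units (`CsDeltaCPstY`, def-Y's `etaDY`), `G ≤ U(N)`,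
  `G`-valued `U`: locality (`…ERowsAtNode00Star.local_elimCΛstY_ofRecordTC`), column mass modulo a star pivot-inverse row `κ_K` (`…colMass_elimCΛstY_ofRecordTC`),
  unitarity of `V = avYOfRecord x U` (`avYOfRecord_mem`), (R3′) (`…PrecisionDoorAtOneStar`) and the TRANSFER of (R5′) to print's Δ_k-row on the STAR subspace
  (`…coercive_CsDeltaCPstY_of_ineq2153_of_units`) DISCHARGED; DISPLAYED, all in star currency and each a theorem at `U = 1`: [5]'s reality of `Δ⁽²⁾(U)` and
  `⟨D̃⁽²⁾·,J⟩(U)` (`IsSymmTr`), the P-row and the 𝒥-row between STAR bonds, the star pivot units `KstY ∕ KTstY` and their inverse row, and the Δ_k-row `γ₀`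
  ([B9] p. 428 «localizing … methods of Sect. B», node N06's G-B9-09).

HONEST SCOPE.  Count-neutral Literature theorems; typed compositions of landed pieces.  DISPLAYED in §3: the two kernel readings on star pairs (node N06's
(3.132) for `(QG₁Q*)⁻¹`, the `J`-row), unitarity of `V`, the star pivot units `IsUnit (KstY …) ∕ IsUnit (KTstY …)` (theorems at `U = 1`, part 3), locality ∕
column mass of `C_st` (theorems, INTENT-21 `…ERowsAtNode00Star`), `γ₀` (a theorem at `U = 1`, INTENT-20).  The `U = 1` assembly with NO analytic row is INTENT-23.
The IDENT for row `h324c` (NODE 00's pin `(𝔖 k).μ = 𝒩(0, 𝕄_Λ̃(η^{d+1}C\*Δ_kC)⁻¹).map Φ`, box, class-II letters, window `b₁ < b₀`) is NOT made; nothing of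
[Balaban1985UV3] ∕ [Balaban1985BackgroundPropagators] ∕ [Balaban1984PropagatorsII] ∕ [Balaban1982Higgs1] ∕ [BenfattoEtAl1978] is asserted beyond what the
tree proves; node N06 ∕ N08 NOT discharged; nothing about `d = 4` specifically, the continuum, OS axioms, a mass gap or Clay.
-/

noncomputable section

open MeasureTheory Finset Matrix

namespace Literature.MathematicalPhysics.QuantumFieldTheory.Balaban1983to89.B1Eq324BenfattoClassSectEMemberPrecisionDoorOnLambdaStar

open Literature.MathematicalPhysics.QuantumFieldTheory
open Literature.MathematicalPhysics.QuantumFieldTheory.Balaban1983to89.B1Eq324BenfattoLemma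
open Literature.MathematicalPhysics.QuantumFieldTheory.Balaban1983to89.B6Ineq2142KLevelV1 (lvl)
open Literature.MathematicalPhysics.QuantumFieldTheory.Balaban1983to89.B9PinMembersKLevelV1 (MemberY)
open Literature.MathematicalPhysics.QuantumFieldTheory.Balaban1983to89.B9PinGeometryKLevelV1 (unitDistY)
open Literature.MathematicalPhysics.QuantumFieldTheory.Balaban1983to89.Node00
open Literature.MathematicalPhysics.QuantumFieldTheory.Balaban1983to89.B1Eq324BenfattoClassSectEMemberCoRead
  (sum_pairing_single coordMatrix_symm_of_selfAdjoint coercive_coordMatrix kernelReading_homog_of_ball abs_coordMatrix_le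
    norm_le_of_iSup_closedBall_le deltaY_eq_single)
open Literature.MathematicalPhysics.QuantumFieldTheory.Balaban1983to89.B1Eq324BenfattoClassSectEMemberCoReadProduct
  (orth_of_repr coordMatrix_sandwich coordMatrix_sub)
open Literature.MathematicalPhysics.QuantumFieldTheory.Balaban1983to89.B1Eq324BenfattoClassSectEMemberAtNode00 (eq324_sectEPrecision_node00_on_unit)
open Literature.MathematicalPhysics.QuantumFieldTheory.Balaban1983to89.B1Eq324BenfattoClassSectEMemberPrecisionDoorOnLambda
  (sum_pairing_secY selfAdjoint_secY_sandwich secY_sandwich_single_apply norm_secY_sandwich_single_le selfAdjoint_real_smul)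

variable {d ℓ : ℕ} {hd : 1 ≤ d + 1} {hL : Odd (ℓ + 1) ∧ 1 < ℓ + 1} {w₀ w₁ : ℝ} {Mstar : ℕ}

/-! ## §1  The STAR-truncated letters `P′ := P_Λ^st (QG₁Q*)⁻¹ P_Λ^st`, `J′ := P_Λ^st (a + ⟨D̃⁽²⁾·,J⟩) P_Λ^st`: `C_st*Δ_kC_st = C_st*·(P′ − J′)·C_st` -/

section Truncation

variable {𝔸 : Type} [NormedRing 𝔸] [NormedAlgebra ℂ 𝔸] [CompleteSpace 𝔸]
variable {x : MemberY d ℓ hd hL w₀ w₁ Mstar} {𝔏 : CovLettersY 𝔸 x} {𝔢 : SectELettersStY 𝔸 x}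

/-- ★ **`C_st*Δ_kC_st = C_st*·(P′ − J′)·C_st` WITH THE STAR-TRUNCATED LETTERS** `P′ := P_Λ^st (QG₁Q*)⁻¹(U) P_Λ^st`, `J′ := P_Λ^st (a + ⟨D̃⁽²⁾·,J⟩(U)) P_Λ^st`
(part 2's `CsDeltaCstY = elimCtΛstY · Δ_k · elimCΛstY` with `elimCtΛstY · P_Λ^st = elimCtΛstY`, `P_Λ^st · elimCΛstY = elimCΛstY`).
[cite: Balaban1985BackgroundPropagators, (3.156)–(3.157) p.428 («B = 0 on Λᶜ … B = CB̃»); Balaban1984PropagatorsII, (2.3) p.224, bookkeeping] -/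
theorem CsDeltaCstY_eq_secΛstY (U : CfgY 𝔸 x.toKIdx) :
    CsDeltaCstY x 𝔏 𝔢 U =
      elimCtΛstY x 𝔢 U * (secΛstY 𝔸 x * 𝔏.QG1Qinv U * secΛstY 𝔸 x - secΛstY 𝔸 x * (aY x.toKIdx + 𝔢.D2J U) * secΛstY 𝔸 x) * elimCΛstY x 𝔢 U := by
  have hC : secΛstY 𝔸 x * elimCΛstY x 𝔢 U = elimCΛstY x 𝔢 U := secΛstY_mul_elimCΛstY U
  have hCt : elimCtΛstY x 𝔢 U * secΛstY 𝔸 x = elimCtΛstY x 𝔢 U := elimCtΛstY_mul_secΛstY U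
  calc CsDeltaCstY x 𝔏 𝔢 U = elimCtΛstY x 𝔢 U * deltaKstY x 𝔏 𝔢 U * elimCΛstY x 𝔢 U := rfl
    _ = (elimCtΛstY x 𝔢 U * secΛstY 𝔸 x) * deltaKstY x 𝔏 𝔢 U * (secΛstY 𝔸 x * elimCΛstY x 𝔢 U) := by rw [hCt, hC]
    _ = elimCtΛstY x 𝔢 U * (secΛstY 𝔸 x * deltaKstY x 𝔏 𝔢 U * secΛstY 𝔸 x) * elimCΛstY x 𝔢 U := by simp only [mul_assoc]
    _ = _ := by rw [deltaKstY_apply, sub_sub, mul_sub, sub_mul]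

/-- the same as ℝ-linear composites. [cite: Balaban1985BackgroundPropagators, (3.156)–(3.157) p.428, bookkeeping] -/
theorem restrictScalars_CsDeltaCstY_eq_comp_secΛstY (U : CfgY 𝔸 x.toKIdx) :
    (CsDeltaCstY x 𝔏 𝔢 U).restrictScalars ℝ =
      (elimCtΛstY x 𝔢 U).restrictScalars ℝ ∘ₗ
        ((secΛstY 𝔸 x * 𝔏.QG1Qinv U * secΛstY 𝔸 x).restrictScalars ℝ -
          (secΛstY 𝔸 x * (aY x.toKIdx + 𝔢.D2J U) * secΛstY 𝔸 x).restrictScalars ℝ) ∘ₗ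
        (elimCΛstY x 𝔢 U).restrictScalars ℝ := by
  rw [CsDeltaCstY_eq_secΛstY]
  apply LinearMap.ext
  intro Φ
  simp only [LinearMap.restrictScalars_apply, LinearMap.comp_apply, LinearMap.sub_apply, Module.End.mul_apply]

/-- ★ **THE PRINT-UNIT LETTER `λ·C_st*Δ_kC_st = C_st*·(P_Λ^st(λ·(QG₁Q*)⁻¹)P_Λ^st − P_Λ^st(λ·(a + ⟨D̃⁽²⁾·,J⟩))P_Λ^st)·C_st`** for any scalar `λ`.
[cite: Balaban1985BackgroundPropagators, (3.156)–(3.157) p.428, (3.16) p.393 (unit conventions), bookkeeping] -/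
theorem smul_CsDeltaCstY_eq_secΛstY (U : CfgY 𝔸 x.toKIdx) (c : ℂ) :
    c • CsDeltaCstY x 𝔏 𝔢 U =
      elimCtΛstY x 𝔢 U * (secΛstY 𝔸 x * (c • 𝔏.QG1Qinv U) * secΛstY 𝔸 x - secΛstY 𝔸 x * (c • (aY x.toKIdx + 𝔢.D2J U)) * secΛstY 𝔸 x) *
        elimCΛstY x 𝔢 U := by
  rw [CsDeltaCstY_eq_secΛstY, ← smul_mul_assoc, ← mul_smul_comm, smul_sub, ← smul_mul_assoc, ← mul_smul_comm, ← smul_mul_assoc, ← mul_smul_comm]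

/-- the same as ℝ-linear composites. [cite: Balaban1985BackgroundPropagators, (3.156)–(3.157) p.428, bookkeeping] -/
theorem restrictScalars_smul_CsDeltaCstY_eq_comp_secΛstY (U : CfgY 𝔸 x.toKIdx) (c : ℂ) :
    (c • CsDeltaCstY x 𝔏 𝔢 U).restrictScalars ℝ =
      (elimCtΛstY x 𝔢 U).restrictScalars ℝ ∘ₗ
        ((secΛstY 𝔸 x * (c • 𝔏.QG1Qinv U) * secΛstY 𝔸 x).restrictScalars ℝ -
          (secΛstY 𝔸 x * (c • (aY x.toKIdx + 𝔢.D2J U)) * secΛstY 𝔸 x).restrictScalars ℝ) ∘ₗ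
        (elimCΛstY x 𝔢 U).restrictScalars ℝ := by
  rw [smul_CsDeltaCstY_eq_secΛstY]
  apply LinearMap.ext
  intro Φ
  simp only [LinearMap.restrictScalars_apply, LinearMap.comp_apply, LinearMap.sub_apply, Module.End.mul_apply]

variable {κ : Type} [Fintype κ] [DecidableEq κ] {σ : Type} [Fintype σ]

/-- ★★ **`𝕄_ι(C_st*Δ_kC_st) = Eᵀ·(𝕄(P′) − 0·1 − 𝕄(J′))·E` WITH THE STAR-TRUNCATED LETTERS**, given the β-adjointness of `elimCΛstY ∕ elimCtΛstY` over the carrier.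
[cite: Balaban1985BackgroundPropagators, (3.156)–(3.157) p.428; Balaban1984PropagatorsII, p.250, dictionary] -/
theorem coordMatrix_CsDeltaCstY_eq_sandwich_secΛstY [DecidableEq (IBondY x.toKIdx)] (U : CfgY 𝔸 x.toKIdx) (β : 𝔸 →ₗ[ℝ] 𝔸 →ₗ[ℝ] ℝ)
    (hβ : ∀ v w, β v w = β w v) (b : Module.Basis κ ℝ 𝔸) (hb : ∀ (v : 𝔸) (c : κ), b.repr v c = β (b c) v) (ι : σ → IBondY x.toKIdx)
    (hadj : ∀ Φ Ψ : IBondY x.toKIdx → 𝔸, ∑ u, β (Ψ u) (((elimCΛstY x 𝔢 U).restrictScalars ℝ) Φ u) =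
      ∑ u, β (((elimCtΛstY x 𝔢 U).restrictScalars ℝ) Ψ u) (Φ u)) :
    (Matrix.of fun p q : σ × κ => β (b p.2) (((CsDeltaCstY x 𝔏 𝔢 U).restrictScalars ℝ) (Pi.single (ι q.1) (b q.2)) (ι p.1))) =
      (Matrix.of fun (v : IBondY x.toKIdx × κ) (q : σ × κ) =>
          β (b v.2) (((elimCΛstY x 𝔢 U).restrictScalars ℝ) (Pi.single (ι q.1) (b q.2)) v.1))ᵀ *
        ((Matrix.of fun u v : IBondY x.toKIdx × κ =>
            β (b u.2) (((secΛstY 𝔸 x * 𝔏.QG1Qinv U * secΛstY 𝔸 x).restrictScalars ℝ) (Pi.single (id v.1) (b v.2)) (id u.1))) -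
          (0 : ℝ) • (1 : Matrix (IBondY x.toKIdx × κ) (IBondY x.toKIdx × κ) ℝ) -
          (Matrix.of fun u v : IBondY x.toKIdx × κ =>
            β (b u.2) (((secΛstY 𝔸 x * (aY x.toKIdx + 𝔢.D2J U) * secΛstY 𝔸 x).restrictScalars ℝ) (Pi.single (id v.1) (b v.2)) (id u.1)))) *
        (Matrix.of fun (v : IBondY x.toKIdx × κ) (q : σ × κ) =>
          β (b v.2) (((elimCΛstY x 𝔢 U).restrictScalars ℝ) (Pi.single (ι q.1) (b q.2)) v.1)) := by
  rw [← coordMatrix_sub β b, restrictScalars_CsDeltaCstY_eq_comp_secΛstY U]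
  exact coordMatrix_sandwich β b hβ hb _ _ _ hadj ι

/-- ★★ **`𝕄_ι(λ·C_st*Δ_kC_st) = Eᵀ·(𝕄(P_Λ^st λ(QG₁Q*)⁻¹ P_Λ^st) − 0·1 − 𝕄(P_Λ^st λ(a + ⟨D̃⁽²⁾·,J⟩) P_Λ^st))·E`** — the print-unit, STAR-truncated sandwich.
[cite: Balaban1985BackgroundPropagators, (3.156)–(3.157) p.428; Balaban1984PropagatorsII, p.250, dictionary] -/
theorem coordMatrix_smul_CsDeltaCstY_eq_sandwich_secΛstY [DecidableEq (IBondY x.toKIdx)] (U : CfgY 𝔸 x.toKIdx) (c : ℂ) (β : 𝔸 →ₗ[ℝ] 𝔸 →ₗ[ℝ] ℝ)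
    (hβ : ∀ v w, β v w = β w v) (b : Module.Basis κ ℝ 𝔸) (hb : ∀ (v : 𝔸) (c' : κ), b.repr v c' = β (b c') v) (ι : σ → IBondY x.toKIdx)
    (hadj : ∀ Φ Ψ : IBondY x.toKIdx → 𝔸, ∑ u, β (Ψ u) (((elimCΛstY x 𝔢 U).restrictScalars ℝ) Φ u) =
      ∑ u, β (((elimCtΛstY x 𝔢 U).restrictScalars ℝ) Ψ u) (Φ u)) :
    (Matrix.of fun p q : σ × κ => β (b p.2) (((c • CsDeltaCstY x 𝔏 𝔢 U).restrictScalars ℝ) (Pi.single (ι q.1) (b q.2)) (ι p.1))) =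
      (Matrix.of fun (v : IBondY x.toKIdx × κ) (q : σ × κ) =>
          β (b v.2) (((elimCΛstY x 𝔢 U).restrictScalars ℝ) (Pi.single (ι q.1) (b q.2)) v.1))ᵀ *
        ((Matrix.of fun u v : IBondY x.toKIdx × κ =>
            β (b u.2) (((secΛstY 𝔸 x * (c • 𝔏.QG1Qinv U) * secΛstY 𝔸 x).restrictScalars ℝ) (Pi.single (id v.1) (b v.2)) (id u.1))) -
          (0 : ℝ) • (1 : Matrix (IBondY x.toKIdx × κ) (IBondY x.toKIdx × κ) ℝ) -
          (Matrix.of fun u v : IBondY x.toKIdx × κ =>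
            β (b u.2) (((secΛstY 𝔸 x * (c • (aY x.toKIdx + 𝔢.D2J U)) * secΛstY 𝔸 x).restrictScalars ℝ) (Pi.single (id v.1) (b v.2)) (id u.1)))) *
        (Matrix.of fun (v : IBondY x.toKIdx × κ) (q : σ × κ) =>
          β (b v.2) (((elimCΛstY x 𝔢 U).restrictScalars ℝ) (Pi.single (ι q.1) (b q.2)) v.1)) := by
  rw [← coordMatrix_sub β b, restrictScalars_smul_CsDeltaCstY_eq_comp_secΛstY U c]
  exact coordMatrix_sandwich β b hβ hb _ _ _ hadj ι

omit [Fintype κ] [DecidableEq κ] [Fintype σ] in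
/-- the door's LOCALITY row of `E` from operator currency, star `C`. [cite: Balaban1985BackgroundPropagators, (3.157) p.428, bookkeeping] -/
theorem locality_coord_of_elimCΛstY [DecidableEq (IBondY x.toKIdx)] (U : CfgY 𝔸 x.toKIdx) (β : 𝔸 →ₗ[ℝ] 𝔸 →ₗ[ℝ] ℝ) (b : Module.Basis κ ℝ 𝔸) (ι : σ → IBondY x.toKIdx) {r : ℝ}
    (hloc : ∀ (s : σ) (w : 𝔸) (u : IBondY x.toKIdx), elimCΛstY x 𝔢 U (Pi.single (ι s) w) u ≠ 0 → unitDistY x u (ι s) ≤ r)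
    (u : IBondY x.toKIdx × κ) (q : σ × κ)
    (h : (Matrix.of fun (v : IBondY x.toKIdx × κ) (q : σ × κ) =>
      β (b v.2) (((elimCΛstY x 𝔢 U).restrictScalars ℝ) (Pi.single (ι q.1) (b q.2)) v.1)) u q ≠ 0) :
    unitDistY x u.1 (ι q.1) ≤ r := by
  refine hloc q.1 (b q.2) u.1 fun h0 => h ?_
  rw [Matrix.of_apply, LinearMap.restrictScalars_apply, h0, map_zero]

omit [DecidableEq κ] [Fintype σ] in
/-- the door's COLUMN-MASS row of `E` from operator currency, star `C`. [cite: Balaban1985BackgroundPropagators, (3.157) p.428, bookkeeping] -/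
theorem colMass_coord_of_elimCΛstY [DecidableEq (IBondY x.toKIdx)] (U : CfgY 𝔸 x.toKIdx) (β : 𝔸 →ₗ[ℝ] 𝔸 →ₗ[ℝ] ℝ) (b : Module.Basis κ ℝ 𝔸) (ι : σ → IBondY x.toKIdx) {cβ m : ℝ}
    (hcβ : 0 ≤ cβ) (hβn : ∀ (c : κ) (v : 𝔸), |β (b c) v| ≤ cβ * ‖v‖)
    (hmass : ∀ (s : σ) (c : κ), ∑ u, ‖elimCΛstY x 𝔢 U (Pi.single (ι s) (b c)) u‖ ≤ m) (q : σ × κ) :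
    ∑ u : IBondY x.toKIdx × κ, |(Matrix.of fun (v : IBondY x.toKIdx × κ) (q : σ × κ) =>
      β (b v.2) (((elimCΛstY x 𝔢 U).restrictScalars ℝ) (Pi.single (ι q.1) (b q.2)) v.1)) u q| ≤ Fintype.card κ * cβ * m := by
  simp only [Matrix.of_apply, LinearMap.restrictScalars_apply]
  rw [Fintype.sum_prod_type]
  calc ∑ u, ∑ c, |β (b c) (elimCΛstY x 𝔢 U (Pi.single (ι q.1) (b q.2)) u)|
      ≤ ∑ u, ∑ _c : κ, cβ * ‖elimCΛstY x 𝔢 U (Pi.single (ι q.1) (b q.2)) u‖ :=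
        Finset.sum_le_sum fun u _ => Finset.sum_le_sum fun c _ => hβn _ _
    _ = Fintype.card κ * cβ * ∑ u, ‖elimCΛstY x 𝔢 U (Pi.single (ι q.1) (b q.2)) u‖ := by
        simp only [Finset.sum_const, Finset.card_univ, nsmul_eq_mul, Finset.mul_sum]
        exact Finset.sum_congr rfl fun u _ => by ring
    _ ≤ Fintype.card κ * cβ * m := mul_le_mul_of_nonneg_left (hmass q.1 q.2) (by positivity)

end Truncation

/-! ## §2  The generic precision door at the STAR letters with (R2′) asked on STAR bonds only -/

section DoorOnLambdaStar

variable {d : ℕ}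

/-- ★★★ **[Balaban1982Higgs1] (3.24) FOR `dμ_{C̃^{(k)}(Λ; U)}` AT NODE 00's STAR LETTERS, PRECISION CURRENCY — (R2′) ON STAR BONDS ONLY, PRINT-UNIT SCALE `λ`.**
p676397 `eq324_CsDeltaCY_precision_node00_onΛ_on_unit` VERBATIM with the star letter record `𝔢 : SectELettersStY`, the star sector `P_Λ^st` and the star dressed
letters: the two kernel readings (R2′a) of `λ(QG₁Q*)⁻¹(U)` and (R2′b) of `λ(a + ⟨D̃⁽²⁾·,J⟩(U))` are asked between bonds `u, v` with a good end block
(`inΛstY x u → inΛstY x v → …`), (R3′) is the β-adjointness of `P_Λ^st C_st P_Λ̃ ∕ P_Λ̃ C_st* P_Λ^st`, (R4′) locality + column mass of `P_Λ^st C_st P_Λ̃`, (R5′) reads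
`λ·C_st*Δ_kC_st` on `ι`-supported `Φ` (`ι` a `Λ̃_st`-valued injective frame index); since `C_st*` reads and `C_st` writes star bonds only,
`𝕄_ι(C_st*Δ_kC_st) = Eᵀ(𝕄(P′) − 𝕄(J′))E` with the STAR-truncated letters (§1).  Conclusion: (3.24) for `𝒩(0, 𝕄_ι(λ·C_st*Δ_kC_st)⁻¹)`.
[cite: Balaban1985BackgroundPropagators, (3.132) p.422, (3.155)–(3.158) pp.427–428, Thm 3.11 p.416; Balaban1984PropagatorsII, p.250, (2.3) p.224, Lemma 2.4 p.245;
Balaban1985UV3, (24) p.262, (58) p.270, pp.271–272; Balaban1982Higgs1, (3.24) p.616; BenfattoEtAl1978, Lemma (4.5)–(4.7) p.152 (class form; bent window, presentation and coordinates ours)] -/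
theorem eq324_CsDeltaCstY_precision_node00_onΛst_on_unit (κ : Type) [Fintype κ] [DecidableEq κ] [Nonempty κ] {γ₀ BP KJ δ r m cβ ne : ℝ}
    (hγ₀ : 0 < γ₀) (hBP : 0 ≤ BP) (hKJ : 0 ≤ KJ) (hδ : 0 < δ) (hm : 0 ≤ m) (hcβ : 0 ≤ cβ) (hne : 0 ≤ ne) (t D : ℕ) {ϰ : ℝ} (hϰ : 0 < ϰ)
    {p₀ σ' c κ' : ℝ} (hp₀ : 2 / 3 < p₀) (hσ : 0 < σ') (hc : 0 ≤ c) (hκ : 0 < κ') (hκσ : κ' < σ' * (t + 1)) :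
    ∃ b₁ : ℝ, ∀ b₀ : ℝ, b₁ < b₀ → ∃ C : ℝ, 0 ≤ C ∧ ∀ η : ℝ, 0 < η → η ≤ 1 →
      ∀ {ℓ : ℕ} {hd : 1 ≤ d + 1} {hL : Odd (ℓ + 1) ∧ 1 < ℓ + 1} {w₀ w₁ : ℝ} {Mstar : ℕ} (x : MemberY d ℓ hd hL w₀ w₁ Mstar)
        [DecidableEq (IBondY x.toKIdx)] {𝔸 : Type} [NormedRing 𝔸] [NormedAlgebra ℂ 𝔸] [CompleteSpace 𝔸] [FiniteDimensional ℝ 𝔸]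
        (𝔏 : CovLettersY 𝔸 x) (𝔢 : SectELettersStY 𝔸 x) (U : CfgY 𝔸 x.toKIdx) (lam : ℝ)
        (β : 𝔸 →ₗ[ℝ] 𝔸 →ₗ[ℝ] ℝ), (∀ v w, β v w = β w v) →
      ∀ (b : Module.Basis κ ℝ 𝔸), (∀ (v : 𝔸) (c' : κ), b.repr v c' = β (b c') v) → (∀ (c' : κ) (v : 𝔸), |β (b c') v| ≤ cβ * ‖v‖) →
        (∀ c', ‖b c'‖ ≤ ne) →
      ∀ {σ : Type} [Fintype σ] [DecidableEq σ] [Nonempty σ] (ι : σ → IBondY x.toKIdx), Function.Injective ι → (∀ s, 𝔢.LamT (ι s)) →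
        (∀ Φ Ψ : IBondY x.toKIdx → 𝔸, ∑ u, β (Ψ u) (((𝔏.QG1Qinv U).restrictScalars ℝ) Φ u) =
          ∑ u, β (((𝔏.QG1Qinv U).restrictScalars ℝ) Ψ u) (Φ u)) →
        (∀ Φ Ψ : IBondY x.toKIdx → 𝔸, ∑ u, β (Ψ u) (((aY x.toKIdx + 𝔢.D2J U).restrictScalars ℝ) Φ u) =
          ∑ u, β (((aY x.toKIdx + 𝔢.D2J U).restrictScalars ℝ) Ψ u) (Φ u)) →
        (∀ u v : IBondY x.toKIdx, inΛstY x u → inΛstY x v →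
          (⨆ E : BallY 𝔸, ‖((lam : ℂ) • 𝔏.QG1Qinv U) (deltaY v (E : 𝔸)) u‖) ≤ BP * Real.exp (-(δ * unitDistY x u v))) →
        (∀ (u v : IBondY x.toKIdx) (E : 𝔸), inΛstY x u → inΛstY x v →
          ‖(((lam : ℂ) • (aY x.toKIdx + 𝔢.D2J U)).restrictScalars ℝ) (Pi.single v E) u‖ ≤ KJ * ‖E‖ * Real.exp (-(δ * unitDistY x u v))) →
        (∀ Φ Ψ : IBondY x.toKIdx → 𝔸, ∑ u, β (Ψ u) (((elimCΛstY x 𝔢 U).restrictScalars ℝ) Φ u) =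
          ∑ u, β (((elimCtΛstY x 𝔢 U).restrictScalars ℝ) Ψ u) (Φ u)) →
        (∀ (s : σ) (w : 𝔸) (u : IBondY x.toKIdx), elimCΛstY x 𝔢 U (Pi.single (ι s) w) u ≠ 0 → unitDistY x u (ι s) ≤ r) →
        (∀ (s : σ) (c' : κ), ∑ u, ‖elimCΛstY x 𝔢 U (Pi.single (ι s) (b c')) u‖ ≤ m) →
        (∀ Φ : IBondY x.toKIdx → 𝔸, (∀ u, u ∉ Set.range ι → Φ u = 0) → (∀ u, Φ u ∈ Submodule.span ℝ (Set.range b)) →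
          γ₀ * ∑ u, β (Φ u) (Φ u) ≤ ∑ u, β (Φ u) ((((lam : ℂ) • CsDeltaCstY x 𝔏 𝔢 U).restrictScalars ℝ) Φ u)) →
      ∃ (Λ : Finset (B1Eq324BenfattoLemma.Site (d + 1 + (d + 1) + 1))) (e' : σ × κ ≃ ↥Λ),
        ((gaussianFieldOfKernel fun u w => if h : u ∈ Λ ∧ w ∈ Λ then
            ((Matrix.reindex e' e'
              (Matrix.of fun p q : σ × κ =>
                  β (b p.2) ((((lam : ℂ) • CsDeltaCstY x 𝔏 𝔢 U).restrictScalars ℝ) (Pi.single (ι q.1) (b q.2)) (ι p.1))))⁻¹ :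
                Matrix ↥Λ ↥Λ ℝ) ⟨u, h.1⟩ ⟨w, h.2⟩ else 0).map
            (fun (z : B1Eq324BenfattoLemma.Site (d + 1 + (d + 1) + 1) → ℝ) (q : σ × κ) =>
              z ((e' q : ↥Λ) : B1Eq324BenfattoLemma.Site (d + 1 + (d + 1) + 1))) =
          gaussianFieldOfKernel fun p q =>
            ((Matrix.of fun p q : σ × κ =>
                β (b p.2) ((((lam : ℂ) • CsDeltaCstY x 𝔏 𝔢 U).restrictScalars ℝ) (Pi.single (ι q.1) (b q.2)) (ι p.1)))⁻¹ :
              Matrix (σ × κ) (σ × κ) ℝ) p q) ∧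
        (∀ p : ℝ, 0 ≤ p →
          ((fun (z : B1Eq324BenfattoLemma.Site (d + 1 + (d + 1) + 1) → ℝ) (q : σ × κ) =>
              z ((e' q : ↥Λ) : B1Eq324BenfattoLemma.Site (d + 1 + (d + 1) + 1))) ⁻¹'
              {ω : σ × κ → ℝ | ∀ q, |ω q| ≤ p}) =ᵐ[gaussianFieldOfKernel fun u w => if h : u ∈ Λ ∧ w ∈ Λ then
                ((Matrix.reindex e' e'
                  (Matrix.of fun p q : σ × κ =>
                      β (b p.2) ((((lam : ℂ) • CsDeltaCstY x 𝔏 𝔢 U).restrictScalars ℝ) (Pi.single (ι q.1) (b q.2)) (ι p.1))))⁻¹ :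
                    Matrix ↥Λ ↥Λ ℝ) ⟨u, h.1⟩ ⟨w, h.2⟩ else 0]
            smallFieldSet Λ p) ∧
        ∀ (s : ℕ) (I J : Finset (B1Eq324BenfattoLemma.Site (d + 1 + (d + 1) + 1))) (𝔞 : Coef (d + 1 + (d + 1) + 1)),
          I.Nonempty → J ⊆ I → J ⊆ Λ → coefSup s D 𝔞 J ≤ c * η ^ σ' →
          0 < ∫ z, cutoffBoltzmann (hamiltonian s D ϰ 𝔞 J) I (B10.pFun b₀ p₀ η) z ∂(gaussianFieldOfKernel fun u w => if h : u ∈ Λ ∧ w ∈ Λ then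
              ((Matrix.reindex e' e'
                (Matrix.of fun p q : σ × κ =>
                    β (b p.2) ((((lam : ℂ) • CsDeltaCstY x 𝔏 𝔢 U).restrictScalars ℝ) (Pi.single (ι q.1) (b q.2)) (ι p.1))))⁻¹ :
                  Matrix ↥Λ ↥Λ ℝ) ⟨u, h.1⟩ ⟨w, h.2⟩ else 0) ∧
            |Real.log (∫ z, cutoffBoltzmann (hamiltonian s D ϰ 𝔞 J) I (B10.pFun b₀ p₀ η) z ∂(gaussianFieldOfKernel fun u w =>
                if h : u ∈ Λ ∧ w ∈ Λ then
                  ((Matrix.reindex e' e'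
                    (Matrix.of fun p q : σ × κ =>
                        β (b p.2) ((((lam : ℂ) • CsDeltaCstY x 𝔏 𝔢 U).restrictScalars ℝ) (Pi.single (ι q.1) (b q.2)) (ι p.1))))⁻¹ :
                      Matrix ↥Λ ↥Λ ℝ) ⟨u, h.1⟩ ⟨w, h.2⟩ else 0)) -
              cumulantSum (gaussianFieldOfKernel fun u w => if h : u ∈ Λ ∧ w ∈ Λ then
                  ((Matrix.reindex e' e'
                    (Matrix.of fun p q : σ × κ =>
                        β (b p.2) ((((lam : ℂ) • CsDeltaCstY x 𝔏 𝔢 U).restrictScalars ℝ) (Pi.single (ι q.1) (b q.2)) (ι p.1))))⁻¹ :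
                      Matrix ↥Λ ↥Λ ℝ) ⟨u, h.1⟩ ⟨w, h.2⟩ else 0)
                (hamiltonian s D ϰ 𝔞 J) t| ≤ C * η ^ κ' * I.card := by
  have hKP : 0 ≤ cβ * ne * BP := by positivity
  have hKJ' : 0 ≤ cβ * ne * KJ := by positivity
  have hmC : 0 ≤ Fintype.card κ * cβ * m := by positivity
  obtain ⟨b₁, hb₁⟩ := eq324_sectEPrecision_node00_on_unit (d := d) κ hγ₀ hKP hKJ' le_rfl hδ hmC t D hϰ hp₀ hσ hc hκ hκσ (r := r)
  refine ⟨b₁, fun b₀ hb₀ => ?_⟩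
  obtain ⟨C, hC, hE⟩ := hb₁ b₀ hb₀
  refine ⟨C, hC, ?_⟩
  intro η hη hηle ℓ hd hL w₀ w₁ Mstar x _ 𝔸 _ _ _ _ 𝔏 𝔢 U lam β hβ b hb hβn hen σ _ _ _ ι hι hιT hPadj hJadj hProw hJker hCadj hloc hmass hco
  have htop : ∀ s, lvl x.hN x.D x.hk (ι s) = x.k := fun s => (𝔢.LamT_inΛst _ (hιT s)).1
  have he : ∀ c₁ c₂ : κ, β (b c₁) (b c₂) = if c₁ = c₂ then 1 else 0 := orth_of_repr β b hb
  have hPs := coordMatrix_symm_of_selfAdjoint β b (id : IBondY x.toKIdx → IBondY x.toKIdx)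
    ((secΛstY 𝔸 x * ((lam : ℂ) • 𝔏.QG1Qinv U) * secΛstY 𝔸 x).restrictScalars ℝ) hβ
    (selfAdjoint_secY_sandwich β (inΛstY x) _ (selfAdjoint_real_smul β (𝔏.QG1Qinv U) lam hPadj))
  have hJs := coordMatrix_symm_of_selfAdjoint β b (id : IBondY x.toKIdx → IBondY x.toKIdx)
    ((secΛstY 𝔸 x * ((lam : ℂ) • (aY x.toKIdx + 𝔢.D2J U)) * secΛstY 𝔸 x).restrictScalars ℝ) hβ
    (selfAdjoint_secY_sandwich β (inΛstY x) _ (selfAdjoint_real_smul β (aY x.toKIdx + 𝔢.D2J U) lam hJadj))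
  have hPΛ : ∀ (u v : IBondY x.toKIdx) (E : 𝔸), inΛstY x u → inΛstY x v →
      ‖((lam : ℂ) • 𝔏.QG1Qinv U) (Pi.single v E) u‖ ≤ BP * ‖E‖ * Real.exp (-(δ * unitDistY x u v)) := by
    intro u v E hu hv
    have hsup : (⨆ E' : ↥(Metric.closedBall (0 : 𝔸) 1), ‖(((lam : ℂ) • 𝔏.QG1Qinv U).restrictScalars ℝ) (Pi.single v (E' : 𝔸)) u‖) ≤
        BP * Real.exp (-(δ * unitDistY x u v)) := by
      have h := hProw u v hu hv
      have hfun : (fun E' : BallY 𝔸 => ‖((lam : ℂ) • 𝔏.QG1Qinv U) (deltaY v (E' : 𝔸)) u‖) =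
          fun E' : ↥(Metric.closedBall (0 : 𝔸) 1) => ‖(((lam : ℂ) • 𝔏.QG1Qinv U).restrictScalars ℝ) (Pi.single v (E' : 𝔸)) u‖ := by
        funext E'; rw [deltaY_eq_single, LinearMap.restrictScalars_apply]
      rw [hfun] at h
      exact h
    have h := kernelReading_homog_of_ball (((lam : ℂ) • 𝔏.QG1Qinv U).restrictScalars ℝ)
      (norm_le_of_iSup_closedBall_le (((lam : ℂ) • 𝔏.QG1Qinv U).restrictScalars ℝ) u v hsup) E
    calc ‖((lam : ℂ) • 𝔏.QG1Qinv U) (Pi.single v E) u‖ = ‖(((lam : ℂ) • 𝔏.QG1Qinv U).restrictScalars ℝ) (Pi.single v E) u‖ := rfl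
      _ ≤ BP * Real.exp (-(δ * unitDistY x u v)) * ‖E‖ := h
      _ = BP * ‖E‖ * Real.exp (-(δ * unitDistY x u v)) := by ring
  have hPker : ∀ (u v : IBondY x.toKIdx) (E : 𝔸),
      ‖((secΛstY 𝔸 x * ((lam : ℂ) • 𝔏.QG1Qinv U) * secΛstY 𝔸 x).restrictScalars ℝ) (Pi.single (id v) E) (id u)‖ ≤
        BP * ‖E‖ * Real.exp (-(δ * unitDistY x u v)) :=
    fun u v E => norm_secY_sandwich_single_le (inΛstY x) ((lam : ℂ) • 𝔏.QG1Qinv U) hBP (unitDistY x) hPΛ u v E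
  have hJker' : ∀ (u v : IBondY x.toKIdx) (E : 𝔸),
      ‖((secΛstY 𝔸 x * ((lam : ℂ) • (aY x.toKIdx + 𝔢.D2J U)) * secΛstY 𝔸 x).restrictScalars ℝ) (Pi.single (id v) E) (id u)‖ ≤
        KJ * ‖E‖ * Real.exp (-(δ * unitDistY x u v)) :=
    fun u v E => norm_secY_sandwich_single_le (inΛstY x) ((lam : ℂ) • (aY x.toKIdx + 𝔢.D2J U)) hKJ (unitDistY x)
      (fun u v E hu hv => hJker u v E hu hv) u v E
  have hP := abs_coordMatrix_le β b (id : IBondY x.toKIdx → IBondY x.toKIdx)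
    ((secΛstY 𝔸 x * ((lam : ℂ) • 𝔏.QG1Qinv U) * secΛstY 𝔸 x).restrictScalars ℝ) hcβ hBP (unitDistY x) hβn hen hPker
  have hJ := abs_coordMatrix_le β b (id : IBondY x.toKIdx → IBondY x.toKIdx)
    ((secΛstY 𝔸 x * ((lam : ℂ) • (aY x.toKIdx + 𝔢.D2J U)) * secΛstY 𝔸 x).restrictScalars ℝ) hcβ hKJ (unitDistY x) hβn hen hJker'
  have hCr := locality_coord_of_elimCΛstY (𝔢 := 𝔢) U β b ι hloc
  have hC1 := colMass_coord_of_elimCΛstY (𝔢 := 𝔢) U β b ι hcβ hβn hmass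
  have hγ := coercive_coordMatrix β b ι (((lam : ℂ) • CsDeltaCstY x 𝔏 𝔢 U).restrictScalars ℝ) he hι hco
  have hsand := coordMatrix_smul_CsDeltaCstY_eq_sandwich_secΛstY (𝔏 := 𝔏) (𝔢 := 𝔢) U (lam : ℂ) β hβ b hb ι hCadj
  rw [hsand] at hγ
  have h := hE η hη hηle x ι hι htop (a := (0 : ℝ)) hPs hJs hP hJ (by rw [abs_zero]) (fun u q huq => hCr u q huq) hC1 hγ
  rw [← hsand] at h
  exact h

/-- Non-vacuity of the scalar side (same letters as p676397's `example`). [cite: Balaban1985UV3, (24) p.262 (letters of the socket; instance ours)] -/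
example :=
  eq324_CsDeltaCstY_precision_node00_onΛst_on_unit (d := 3) (Fin 24) (γ₀ := 1) (BP := 1) (KJ := 1) (δ := 1) (r := 2) (m := 9) (cβ := 1) (ne := 1)
    one_pos zero_le_one zero_le_one one_pos (by norm_num) zero_le_one zero_le_one 6 4 (ϰ := 1) one_pos (p₀ := 1) (σ' := 1 / 2) (c := 1)
    (κ' := 13 / 4) (by norm_num) (by norm_num) zero_le_one (by norm_num) (by norm_num)

end DoorOnLambdaStar

/-! ## §3  The record edition at the seven-letter STAR record: the record fibre `M_N(ℂ)`, (R1′) in `IsSymmTr` currency, (R3′) and the frame constants discharged -/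

section DoorAtRecord

open scoped Matrix.Norms.L2Operator
open B7Prop2Explicit (unitaryUnits)
open B9Thm311ReadingCoords (trIP IsSymmTr)
open B9CoReadingCoordsTranspose (trReForm trReForm_symm sum_trReForm_eq_trIP TrIdx trBasis)
open B1Eq324BenfattoClassSectEMemberCoRead (trReForm_trBasis_eq_repr)
open B1Eq324BenfattoClassSectEMemberRealAdjointAtNode00 (abs_trReForm_trBasis_le norm_trBasis_le selfAdjoint_QG1Qinv_of_isSymmTr
  selfAdjoint_aY_add_D2J_of_isSymmTr)
open B1Eq324BenfattoClassSectEMemberPrecisionDoorAtOneStar (sum_trReForm_elimCΛstY_ofRecordTC)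

/-- ★★★ **THE DOOR AT THE RECORD FIBRE `M_N(ℂ)`, STAR LETTERS, (R2′) ON STAR BONDS ONLY, PRINT-UNIT SCALE `λ`** — p676397 §3
`eq324_CsDeltaCY_precision_ofRecordTC_trBasis_onΛ_on_unit` VERBATIM at the seven-letter STAR record `sectELettersStYOfRecordTC x 𝔳 𝔢₀` (part 3): (R1′) in `IsSymmTr 1`
currency (`(QG₁Q*)⁻¹(U)` and `𝔢₀.D2J U` — the star record keeps `𝔢₀`'s `D2J`), the two kernel readings for star pairs `u, v` (`inΛstY`), (R3′) DISCHARGED by unitarity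
of `V = 𝔳 U` + the STAR pivot units (`…PrecisionDoorAtOneStar.sum_trReForm_elimCΛstY_ofRecordTC`), frame constants `1` (`trBasis ∕ trReForm`), (R4′) locality + column
mass of `P_Λ^st C_st P_Λ̃`, (R5′) `γ₀` for `λ·C_st*Δ_kC_st` in `trIP 1`.  Conclusion: (3.24) for `𝒩(0, 𝕄_ι(λ·C_st*Δ_kC_st)⁻¹)`.
[cite: Balaban1985BackgroundPropagators, (3.132) p.422, (3.155)–(3.158) pp.427–428, Thm 3.11 p.416, p.391; Balaban1984PropagatorsII, (2.3) p.224, Lemma 2.4 p.245;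
Balaban1985UV3, (24) p.262, pp.271–272; Balaban1982Higgs1, (3.24) p.616; BenfattoEtAl1978, Lemma (4.5)–(4.7) p.152 (class form; bent window, presentation and coordinates ours)] -/
theorem eq324_CsDeltaCstY_precision_ofRecordTC_trBasis_onΛst_on_unit (N : ℕ) [NeZero N] {γ₀ BP KJ δ r m : ℝ}
    (hγ₀ : 0 < γ₀) (hBP : 0 ≤ BP) (hKJ : 0 ≤ KJ) (hδ : 0 < δ) (hm : 0 ≤ m) (t D : ℕ) {ϰ : ℝ} (hϰ : 0 < ϰ)
    {p₀ σ' c κ' : ℝ} (hp₀ : 2 / 3 < p₀) (hσ : 0 < σ') (hc : 0 ≤ c) (hκ : 0 < κ') (hκσ : κ' < σ' * (t + 1)) :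
    ∃ b₁ : ℝ, ∀ b₀ : ℝ, b₁ < b₀ → ∃ C : ℝ, 0 ≤ C ∧ ∀ η : ℝ, 0 < η → η ≤ 1 →
      ∀ {ℓ : ℕ} {hd : 1 ≤ d + 1} {hL : Odd (ℓ + 1) ∧ 1 < ℓ + 1} {w₀ w₁ : ℝ} {Mstar : ℕ} (x : MemberY d ℓ hd hL w₀ w₁ Mstar)
        [DecidableEq (IBondY x.toKIdx)]
        (𝔏 : CovLettersY (Matrix (Fin N) (Fin N) ℂ) x) (𝔳 : AvY (Matrix (Fin N) (Fin N) ℂ) x) (𝔢₀ : SectELettersY (Matrix (Fin N) (Fin N) ℂ) x)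
        (U : CfgY (Matrix (Fin N) (Fin N) ℂ) x.toKIdx) (lam : ℝ)
      {σ : Type} [Fintype σ] [DecidableEq σ] [Nonempty σ] (ι : σ → IBondY x.toKIdx), Function.Injective ι → (∀ s, lamTstY x (ι s)) →
        IsSymmTr (fun _ => (1 : ℝ)) (𝔏.QG1Qinv U) →
        IsSymmTr (fun _ => (1 : ℝ)) (𝔢₀.D2J U) →
        (∀ u v : IBondY x.toKIdx, inΛstY x u → inΛstY x v →
          (⨆ E : BallY (Matrix (Fin N) (Fin N) ℂ), ‖((lam : ℂ) • 𝔏.QG1Qinv U) (deltaY v (E : Matrix (Fin N) (Fin N) ℂ)) u‖) ≤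
            BP * Real.exp (-(δ * unitDistY x u v))) →
        (∀ (u v : IBondY x.toKIdx) (E : Matrix (Fin N) (Fin N) ℂ), inΛstY x u → inΛstY x v →
          ‖(((lam : ℂ) • (aY x.toKIdx + 𝔢₀.D2J U)).restrictScalars ℝ) (Pi.single v E) u‖ ≤ KJ * ‖E‖ * Real.exp (-(δ * unitDistY x u v))) →
        (∀ b : UBondY x, ((𝔳 U b : (Matrix (Fin N) (Fin N) ℂ)ˣ) : Matrix (Fin N) (Fin N) ℂ) ∈ unitary (Matrix (Fin N) (Fin N) ℂ)) →
        (∀ c' : CBondStY x, IsUnit (KstY x 𝔳 U c')) → (∀ c' : CBondStY x, IsUnit (KTstY x 𝔳 U c')) →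
        (∀ (s : σ) (w : Matrix (Fin N) (Fin N) ℂ) (u : IBondY x.toKIdx),
          elimCΛstY x (sectELettersStYOfRecordTC x 𝔳 𝔢₀) U (Pi.single (ι s) w) u ≠ 0 → unitDistY x u (ι s) ≤ r) →
        (∀ (s : σ) (c' : TrIdx N), ∑ u, ‖elimCΛstY x (sectELettersStYOfRecordTC x 𝔳 𝔢₀) U (Pi.single (ι s) (trBasis N c')) u‖ ≤ m) →
        (∀ Φ : IBondY x.toKIdx → Matrix (Fin N) (Fin N) ℂ, (∀ u, u ∉ Set.range ι → Φ u = 0) →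
          γ₀ * trIP (fun _ => (1 : ℝ)) Φ Φ ≤ trIP (fun _ => (1 : ℝ)) Φ (((lam : ℂ) • CsDeltaCstY x 𝔏 (sectELettersStYOfRecordTC x 𝔳 𝔢₀) U) Φ)) →
      ∃ (Λ : Finset (B1Eq324BenfattoLemma.Site (d + 1 + (d + 1) + 1))) (e' : σ × TrIdx N ≃ ↥Λ),
        ((gaussianFieldOfKernel fun u w => if h : u ∈ Λ ∧ w ∈ Λ then
            ((Matrix.reindex e' e'
              (Matrix.of fun p q : σ × TrIdx N =>
                  trReForm (trBasis N p.2) ((((lam : ℂ) • CsDeltaCstY x 𝔏 (sectELettersStYOfRecordTC x 𝔳 𝔢₀) U).restrictScalars ℝ)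
                    (Pi.single (ι q.1) (trBasis N q.2)) (ι p.1))))⁻¹ :
                Matrix ↥Λ ↥Λ ℝ) ⟨u, h.1⟩ ⟨w, h.2⟩ else 0).map
            (fun (z : B1Eq324BenfattoLemma.Site (d + 1 + (d + 1) + 1) → ℝ) (q : σ × TrIdx N) => z ((e' q : ↥Λ) : B1Eq324BenfattoLemma.Site (d + 1 + (d + 1) + 1))) =
          gaussianFieldOfKernel fun p q =>
            ((Matrix.of fun p q : σ × TrIdx N =>
                trReForm (trBasis N p.2) ((((lam : ℂ) • CsDeltaCstY x 𝔏 (sectELettersStYOfRecordTC x 𝔳 𝔢₀) U).restrictScalars ℝ)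
                  (Pi.single (ι q.1) (trBasis N q.2)) (ι p.1)))⁻¹ :
              Matrix (σ × TrIdx N) (σ × TrIdx N) ℝ) p q) ∧
        (∀ p : ℝ, 0 ≤ p →
          ((fun (z : B1Eq324BenfattoLemma.Site (d + 1 + (d + 1) + 1) → ℝ) (q : σ × TrIdx N) => z ((e' q : ↥Λ) : B1Eq324BenfattoLemma.Site (d + 1 + (d + 1) + 1))) ⁻¹'
              {ω : σ × TrIdx N → ℝ | ∀ q, |ω q| ≤ p}) =ᵐ[gaussianFieldOfKernel fun u w => if h : u ∈ Λ ∧ w ∈ Λ then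
                ((Matrix.reindex e' e'
                  (Matrix.of fun p q : σ × TrIdx N =>
                      trReForm (trBasis N p.2) ((((lam : ℂ) • CsDeltaCstY x 𝔏 (sectELettersStYOfRecordTC x 𝔳 𝔢₀) U).restrictScalars ℝ)
                        (Pi.single (ι q.1) (trBasis N q.2)) (ι p.1))))⁻¹ :
                    Matrix ↥Λ ↥Λ ℝ) ⟨u, h.1⟩ ⟨w, h.2⟩ else 0]
            smallFieldSet Λ p) ∧
        ∀ (s : ℕ) (I J : Finset (B1Eq324BenfattoLemma.Site (d + 1 + (d + 1) + 1))) (𝔞 : Coef (d + 1 + (d + 1) + 1)),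
          I.Nonempty → J ⊆ I → J ⊆ Λ → coefSup s D 𝔞 J ≤ c * η ^ σ' →
          0 < ∫ z, cutoffBoltzmann (hamiltonian s D ϰ 𝔞 J) I (B10.pFun b₀ p₀ η) z ∂(gaussianFieldOfKernel fun u w => if h : u ∈ Λ ∧ w ∈ Λ then
              ((Matrix.reindex e' e'
                (Matrix.of fun p q : σ × TrIdx N =>
                    trReForm (trBasis N p.2) ((((lam : ℂ) • CsDeltaCstY x 𝔏 (sectELettersStYOfRecordTC x 𝔳 𝔢₀) U).restrictScalars ℝ)
                      (Pi.single (ι q.1) (trBasis N q.2)) (ι p.1))))⁻¹ :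
                  Matrix ↥Λ ↥Λ ℝ) ⟨u, h.1⟩ ⟨w, h.2⟩ else 0) ∧
            |Real.log (∫ z, cutoffBoltzmann (hamiltonian s D ϰ 𝔞 J) I (B10.pFun b₀ p₀ η) z ∂(gaussianFieldOfKernel fun u w =>
                if h : u ∈ Λ ∧ w ∈ Λ then
                  ((Matrix.reindex e' e'
                    (Matrix.of fun p q : σ × TrIdx N =>
                        trReForm (trBasis N p.2) ((((lam : ℂ) • CsDeltaCstY x 𝔏 (sectELettersStYOfRecordTC x 𝔳 𝔢₀) U).restrictScalars ℝ)
                          (Pi.single (ι q.1) (trBasis N q.2)) (ι p.1))))⁻¹ :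
                      Matrix ↥Λ ↥Λ ℝ) ⟨u, h.1⟩ ⟨w, h.2⟩ else 0)) -
              cumulantSum (gaussianFieldOfKernel fun u w => if h : u ∈ Λ ∧ w ∈ Λ then
                  ((Matrix.reindex e' e'
                    (Matrix.of fun p q : σ × TrIdx N =>
                        trReForm (trBasis N p.2) ((((lam : ℂ) • CsDeltaCstY x 𝔏 (sectELettersStYOfRecordTC x 𝔳 𝔢₀) U).restrictScalars ℝ)
                          (Pi.single (ι q.1) (trBasis N q.2)) (ι p.1))))⁻¹ :
                      Matrix ↥Λ ↥Λ ℝ) ⟨u, h.1⟩ ⟨w, h.2⟩ else 0)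
                (hamiltonian s D ϰ 𝔞 J) t| ≤ C * η ^ κ' * I.card := by
  obtain ⟨b₁, hb₁⟩ := eq324_CsDeltaCstY_precision_node00_onΛst_on_unit (d := d) (TrIdx N) (cβ := 1) (ne := 1) hγ₀ hBP hKJ hδ hm zero_le_one
    zero_le_one t D hϰ hp₀ hσ hc hκ hκσ (r := r)
  refine ⟨b₁, fun b₀ hb₀ => ?_⟩
  obtain ⟨C, hC, hE⟩ := hb₁ b₀ hb₀
  refine ⟨C, hC, ?_⟩
  intro η hη hηle ℓ hd hL w₀ w₁ Mstar x _ 𝔏 𝔳 𝔢₀ U lam σ _ _ _ ι hι hιT hPs hJs hProw hJker h𝔳 hK hKT hloc hmass hco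
  exact hE η hη hηle x 𝔏 (sectELettersStYOfRecordTC x 𝔳 𝔢₀) U lam trReForm trReForm_symm (trBasis N)
    (fun v c' => (trReForm_trBasis_eq_repr v c').symm) abs_trReForm_trBasis_le norm_trBasis_le ι hι hιT
    (selfAdjoint_QG1Qinv_of_isSymmTr x 𝔏 hPs) (selfAdjoint_aY_add_D2J_of_isSymmTr x 𝔢₀ hJs) hProw hJker
    (sum_trReForm_elimCΛstY_ofRecordTC x 𝔳 𝔢₀ h𝔳 hK hKT) hloc hmass
    (fun Φ hΦ _ => by rw [LinearMap.coe_restrictScalars, sum_trReForm_eq_trIP, sum_trReForm_eq_trIP]; exact hco Φ hΦ)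

end DoorAtRecord

/-! ## §4  THE DOOR OF RECORD AT THE STAR LETTERS, GENERAL BACKGROUND: NODE 00's own rows discharged, node N06's rows displayed in star currency -/

section DoorOfRecordStar

open scoped Matrix.Norms.L2Operator
open B7Prop2Explicit (unitaryUnits)
open B9Thm311ReadingCoords (trIP IsSymmTr)
open B9CoReadingCoordsTranspose (trReForm TrIdx trBasis)
open B9PinMembersKLevelV1 (geo9Y)
open B1Eq324BenfattoClassSectEMemberRealAdjointAtNode00 (norm_trBasis_le lettersYOfRecordV4_QG1Qinv_isSymmTr)
open B1Eq324BenfattoClassSectEMemberPrecisionDoorAtOneStar (coercive_CsDeltaCPstY_of_ineq2153_of_units)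
open B1Eq324BenfattoClassSectEMemberERowsAtNode00Star (local_elimCΛstY_ofRecordTC colMass_elimCΛstY_ofRecordTC)

/-- ★★★ **THE (3.24) PRECISION DOOR OF RECORD AT NODE 00's STAR LETTERS, GENERAL BACKGROUND `U`** — §3 at the v4 letters of record `lettersYOfRecordV4 N θ M⋆ 𝔯 x`
(any residual family), the averaged field OF RECORD `V = avYOfRecord x U` and the v7 STAR Sect. E record `sectEStYOfRecordV7 N θ M⋆ 𝔢₀ x`, in print units (the
conclusion is (3.24) for `𝒩(0, 𝕄_ι(CsDeltaCPstY x (lettersYOfRecordV4 …) (sectEStYOfRecordV7 …) U)⁻¹)`, scale `λ_x = etaDY x = η^{d+1}`).  DISCHARGED here (NODE 00's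
own rows, every background): locality radius `ℓ + 2` and column mass `(1 + κ_K)·1` of `C_st(V)` (`…ERowsAtNode00Star`), unitarity of `V` (`G ≤ U(N)`, `G`-valued `U`),
(R3′) `C_st ∕ C_st*` adjoint and the TRANSFER of the `γ₀` row from print's Δ_k-row on the STAR subspace (`…PrecisionDoorAtOneStar` §1–§2), frame constants.  DISPLAYED,
each in star currency and each a THEOREM at `U = 1` (§4 of `…PrecisionDoorAtOneStarAssembled` discharges them all there): the reality rows `IsSymmTr 1 ((𝔯 x).Δ2 U)`,
`IsSymmTr 1 ((𝔢₀ x).D2J U)` ([5]'s `C⁽²⁾ ∕ D̃⁽²⁾`), node N06's (3.132) P-row and the 𝒥-row between STAR bonds, the star pivot units `IsUnit (KstY …) ∕ IsUnit (KTstY …)`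
with a pivot-inverse row `‖K_c(V)⁻¹a‖ ≤ κ_K L^{d+1}‖a‖` ([B9] (3.35) regime — the star twins of def-Y's `OpsYSectEElimSmall ∕ …Axial`), and the Δ_k-row `γ₀` on print's
STAR subspace «`B = 0` off `inΛstY`, on the axial trees, `(Q(V)B)(c) = 0` at every star corner» ([B9] p. 428 «localizing … methods of Sect. B», node N06's G-B9-09).
[cite: Balaban1985BackgroundPropagators, (3.35) p.396, (3.132) p.422, (3.155)–(3.158) pp.427–428, Thm 3.11 p.416; Balaban1984PropagatorsII, (2.3) p.224, Lemma 2.4 p.245,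
(2.153)–(2.156) pp.249–250; Balaban1985UV3, (24) p.262, pp.271–272; Balaban1982Higgs1, (3.24) p.616; BenfattoEtAl1978, Lemma (4.5)–(4.7) p.152 (class form; bent window,
presentation and coordinates ours)] -/
theorem eq324_CsDeltaCPstY_sectEStYOfRecordV7_trBasis_of_units_onΛst_on_unit (N : ℕ) [NeZero N] (θ : Stage3Params) (Mstar : ℕ)
    (𝔯 : ResY N θ Mstar) (𝔢₀ : SectEY N θ Mstar) {γ₀ BP KJ δ κK : ℝ} (hγ₀ : 0 < γ₀) (hBP : 0 ≤ BP) (hKJ : 0 ≤ KJ) (hδ : 0 < δ) (hκK : 0 ≤ κK)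
    (t D : ℕ) {ϰ : ℝ} (hϰ : 0 < ϰ) {p₀ σ' c κ' : ℝ} (hp₀ : 2 / 3 < p₀) (hσ : 0 < σ') (hc : 0 ≤ c) (hκ : 0 < κ') (hκσ : κ' < σ' * (t + 1)) :
    ∃ b₁ : ℝ, ∀ b₀ : ℝ, b₁ < b₀ → ∃ C : ℝ, 0 ≤ C ∧ ∀ η : ℝ, 0 < η → η ≤ 1 →
      ∀ (x : MemberY θ.d₆ θ.ℓ₆ θ.hd' θ.hL' θ.b₀ θ.b₁ Mstar) [DecidableEq (IBondY x.toKIdx)]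
        {G : Subgroup (Matrix (Fin N) (Fin N) ℂ)ˣ}, G ≤ unitaryUnits (Matrix (Fin N) (Fin N) ℂ) →
      ∀ (U : CfgY (Matrix (Fin N) (Fin N) ℂ) x.toKIdx), (∀ μ z, U μ z ∈ G) →
        IsSymmTr (fun _ => (1 : ℝ)) ((𝔯 x).Δ2 U) → IsSymmTr (fun _ => (1 : ℝ)) ((𝔢₀ x).D2J U) →
      ∀ {σ : Type} [Fintype σ] [DecidableEq σ] [Nonempty σ] (ι : σ → IBondY x.toKIdx), Function.Injective ι → (∀ s, lamTstY x (ι s)) →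
        (∀ u v : IBondY x.toKIdx, inΛstY x u → inΛstY x v →
          (⨆ E : BallY (Matrix (Fin N) (Fin N) ℂ), ‖(((etaDY x : ℝ) : ℂ) • (lettersYOfRecordV4 N θ Mstar 𝔯 x).QG1Qinv U)
              (deltaY v (E : Matrix (Fin N) (Fin N) ℂ)) u‖) ≤ BP * Real.exp (-(δ * unitDistY x u v))) →
        (∀ (u v : IBondY x.toKIdx) (E : Matrix (Fin N) (Fin N) ℂ), inΛstY x u → inΛstY x v →
          ‖((((etaDY x : ℝ) : ℂ) • (aY x.toKIdx + (𝔢₀ x).D2J U)).restrictScalars ℝ) (Pi.single v E) u‖ ≤ KJ * ‖E‖ * Real.exp (-(δ * unitDistY x u v))) →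
        (∀ c' : CBondStY x, IsUnit (KstY x (avYOfRecord x) U c')) → (∀ c' : CBondStY x, IsUnit (KTstY x (avYOfRecord x) U c')) →
        (∀ (c' : CBondStY x) (a : Matrix (Fin N) (Fin N) ℂ),
          ‖Ring.inverse (KstY x (avYOfRecord x) U c') a‖ ≤ κK * (((θ.ℓ₆ + 1 : ℕ) : ℝ)) ^ (θ.d₆ + 1) * ‖a‖) →
        (∀ B : IBondY x.toKIdx → Matrix (Fin N) (Fin N) ℂ, (∀ q, ¬ inΛstY x q → B q = 0) → (∀ q, IsAxialY x q → B q = 0) →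
          (∀ c' : CBondStY x, Q1Y x (avYOfRecord x) U c'.1 B = 0) →
          γ₀ * trIP (fun _ => (1 : ℝ)) B B ≤
            trIP (fun _ => (1 : ℝ)) B (deltaKPstY x (lettersYOfRecordV4 N θ Mstar 𝔯 x) (sectEStYOfRecordV7 N θ Mstar 𝔢₀ x) U B)) →
      ∃ (Λ : Finset (B1Eq324BenfattoLemma.Site (θ.d₆ + 1 + (θ.d₆ + 1) + 1))) (e' : σ × TrIdx N ≃ ↥Λ),
        ((gaussianFieldOfKernel fun u w => if h : u ∈ Λ ∧ w ∈ Λ then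
            ((Matrix.reindex e' e'
              (Matrix.of fun p q : σ × TrIdx N =>
                  trReForm (trBasis N p.2) (((CsDeltaCPstY x (lettersYOfRecordV4 N θ Mstar 𝔯 x)
            (sectEStYOfRecordV7 N θ Mstar 𝔢₀ x) U).restrictScalars ℝ)
                    (Pi.single (ι q.1) (trBasis N q.2)) (ι p.1))))⁻¹ :
                Matrix ↥Λ ↥Λ ℝ) ⟨u, h.1⟩ ⟨w, h.2⟩ else 0).map
            (fun (z : B1Eq324BenfattoLemma.Site (θ.d₆ + 1 + (θ.d₆ + 1) + 1) → ℝ) (q : σ × TrIdx N) => z ((e' q : ↥Λ) : B1Eq324BenfattoLemma.Site (θ.d₆ + 1 + (θ.d₆ + 1) + 1))) =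
          gaussianFieldOfKernel fun p q =>
            ((Matrix.of fun p q : σ × TrIdx N =>
                trReForm (trBasis N p.2) (((CsDeltaCPstY x (lettersYOfRecordV4 N θ Mstar 𝔯 x)
            (sectEStYOfRecordV7 N θ Mstar 𝔢₀ x) U).restrictScalars ℝ)
                  (Pi.single (ι q.1) (trBasis N q.2)) (ι p.1)))⁻¹ :
              Matrix (σ × TrIdx N) (σ × TrIdx N) ℝ) p q) ∧
        (∀ p : ℝ, 0 ≤ p →
          ((fun (z : B1Eq324BenfattoLemma.Site (θ.d₆ + 1 + (θ.d₆ + 1) + 1) → ℝ) (q : σ × TrIdx N) => z ((e' q : ↥Λ) : B1Eq324BenfattoLemma.Site (θ.d₆ + 1 + (θ.d₆ + 1) + 1))) ⁻¹'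
              {ω : σ × TrIdx N → ℝ | ∀ q, |ω q| ≤ p}) =ᵐ[gaussianFieldOfKernel fun u w => if h : u ∈ Λ ∧ w ∈ Λ then
                ((Matrix.reindex e' e'
                  (Matrix.of fun p q : σ × TrIdx N =>
                      trReForm (trBasis N p.2) (((CsDeltaCPstY x (lettersYOfRecordV4 N θ Mstar 𝔯 x)
            (sectEStYOfRecordV7 N θ Mstar 𝔢₀ x) U).restrictScalars ℝ)
                        (Pi.single (ι q.1) (trBasis N q.2)) (ι p.1))))⁻¹ :
                    Matrix ↥Λ ↥Λ ℝ) ⟨u, h.1⟩ ⟨w, h.2⟩ else 0]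
            smallFieldSet Λ p) ∧
        ∀ (s : ℕ) (I J : Finset (B1Eq324BenfattoLemma.Site (θ.d₆ + 1 + (θ.d₆ + 1) + 1))) (𝔞 : Coef (θ.d₆ + 1 + (θ.d₆ + 1) + 1)),
          I.Nonempty → J ⊆ I → J ⊆ Λ → coefSup s D 𝔞 J ≤ c * η ^ σ' →
          0 < ∫ z, cutoffBoltzmann (hamiltonian s D ϰ 𝔞 J) I (B10.pFun b₀ p₀ η) z ∂(gaussianFieldOfKernel fun u w => if h : u ∈ Λ ∧ w ∈ Λ then
              ((Matrix.reindex e' e'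
                (Matrix.of fun p q : σ × TrIdx N =>
                    trReForm (trBasis N p.2) (((CsDeltaCPstY x (lettersYOfRecordV4 N θ Mstar 𝔯 x)
            (sectEStYOfRecordV7 N θ Mstar 𝔢₀ x) U).restrictScalars ℝ)
                      (Pi.single (ι q.1) (trBasis N q.2)) (ι p.1))))⁻¹ :
                  Matrix ↥Λ ↥Λ ℝ) ⟨u, h.1⟩ ⟨w, h.2⟩ else 0) ∧
            |Real.log (∫ z, cutoffBoltzmann (hamiltonian s D ϰ 𝔞 J) I (B10.pFun b₀ p₀ η) z ∂(gaussianFieldOfKernel fun u w =>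
                if h : u ∈ Λ ∧ w ∈ Λ then
                  ((Matrix.reindex e' e'
                    (Matrix.of fun p q : σ × TrIdx N =>
                        trReForm (trBasis N p.2) (((CsDeltaCPstY x (lettersYOfRecordV4 N θ Mstar 𝔯 x)
            (sectEStYOfRecordV7 N θ Mstar 𝔢₀ x) U).restrictScalars ℝ)
                          (Pi.single (ι q.1) (trBasis N q.2)) (ι p.1))))⁻¹ :
                      Matrix ↥Λ ↥Λ ℝ) ⟨u, h.1⟩ ⟨w, h.2⟩ else 0)) -
              cumulantSum (gaussianFieldOfKernel fun u w => if h : u ∈ Λ ∧ w ∈ Λ then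
                  ((Matrix.reindex e' e'
                    (Matrix.of fun p q : σ × TrIdx N =>
                        trReForm (trBasis N p.2) (((CsDeltaCPstY x (lettersYOfRecordV4 N θ Mstar 𝔯 x)
            (sectEStYOfRecordV7 N θ Mstar 𝔢₀ x) U).restrictScalars ℝ)
                          (Pi.single (ι q.1) (trBasis N q.2)) (ι p.1))))⁻¹ :
                      Matrix ↥Λ ↥Λ ℝ) ⟨u, h.1⟩ ⟨w, h.2⟩ else 0)
                (hamiltonian s D ϰ 𝔞 J) t| ≤ C * η ^ κ' * I.card := by
  have hm : (0 : ℝ) ≤ (1 + κK) * 1 := by positivity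
  obtain ⟨b₁, hb₁⟩ := eq324_CsDeltaCstY_precision_ofRecordTC_trBasis_onΛst_on_unit (d := θ.d₆) N hγ₀ hBP hKJ hδ hm t D hϰ hp₀ hσ hc hκ hκσ
    (r := (θ.ℓ₆ : ℝ) + 2)
  refine ⟨b₁, fun b₀ hb₀ => ?_⟩
  obtain ⟨C, hC, hE⟩ := hb₁ b₀ hb₀
  refine ⟨C, hC, ?_⟩
  intro η hη hηle x _ G hG U hU hΔ2 hD2J σ _ _ _ ι hι hιT hProw hJker hK hKT hKinv hco
  have h𝔳 : ∀ b : UBondY x, ((avYOfRecord x U b : (Matrix (Fin N) (Fin N) ℂ)ˣ) : Matrix (Fin N) (Fin N) ℂ) ∈ unitary (Matrix (Fin N) (Fin N) ℂ) :=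
    fun b => B7Prop2Explicit.mem_unitaryUnits.mp (hG (avYOfRecord_mem x hU b))
  exact hE η hη hηle x (lettersYOfRecordV4 N θ Mstar 𝔯 x) (avYOfRecord x) (𝔢₀ x) U (etaDY x) ι hι hιT
    (lettersYOfRecordV4_QG1Qinv_isSymmTr θ Mstar 𝔯 hG x hU hΔ2) hD2J hProw hJker h𝔳 hK hKT
    (local_elimCΛstY_ofRecordTC x (avYOfRecord x) (𝔢₀ x) U ι)
    (colMass_elimCΛstY_ofRecordTC x (avYOfRecord x) (𝔢₀ x) (norm_coe_le_one_of_le_unitaryUnits hG) (fun b => avYOfRecord_mem x hU b) hκK hKinv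
      (fun c' => trBasis N c') norm_trBasis_le ι)
    (fun Φ hΦ => coercive_CsDeltaCPstY_of_ineq2153_of_units x (avYOfRecord x) (lettersYOfRecordV4 N θ Mstar 𝔯 x) (𝔢₀ x) h𝔳 hK hKT hγ₀.le hco Φ
      fun q hq => hΦ q fun hq' => hq (by obtain ⟨s, rfl⟩ := hq'; exact hιT s))

end DoorOfRecordStar

end Literature.MathematicalPhysics.QuantumFieldTheory.Balaban1983to89.B1Eq324BenfattoClassSectEMemberPrecisionDoorOnLambdaStar

end
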